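import Summits.BirchSwinnertonDyer.BirchSwinnertonDyer.Theorems.ResidualThetaTransportAtTwoThetaLayerLambdaCongruenceAtTwoCuspSpanJacobi
import HarnessLib

/-!
# Route `ResidualThetaTransportAtTwo`, cruxes Kan⁺ (stmt-BirchSwinnertonDyer-20688) / node 27436 / 21437: ONE-STEP COBOUNDARY PROPAGATION —
# the node at an odd prime from realised coset pairs WITHOUT requiring all of them

Cell `bsd-wall`, width seat `bsd-wall-rtt-p3-w5` g2 (2026-08-28). THEOREMS ONLY; `--supports stmt-BirchSwinnertonDyer-20688`; BSD is not proved
by this. Sharpening of the coset-pair criterion (`…CuspSpanCosetPairs`, p638324).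

With `H := ⟨4, −1⟩ ≤ 𝔽ₚˣ` and an `H`-invariant `F : 𝔽ₚˣ → 𝔽₂`, put `D(x, y) := F(x) + F(y) + F(xy)` (the coboundary). Manin's three-term rule
kills `D(s, t)` whenever the pair is REALISED: some `h₁, h₂ ∈ H` have `s h₁ + s t h₂ = 1` (then `u := s h₁ ∈ sH`, `u − 1 ∈ stH`,
`(u−1)/u ∈ tH`). The coboundary satisfies the 2-cocycle identity `D(a, x) = D(a, b) + D(ab, x/b) + D(b, x/b)` for every `b`, so
`D(a, x) = 0` as soon as ONE `b` has the three pairs `(a, b)`, `(ab, x/b)`, `(b, x/b)` realised — in the «`s h₁ + c h₂ = 1`» currency: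
`Good(a, ab)`, `Good(ab, ax)`, `Good(b, x)`.

* `mul_of_oneStep`: if for all units `a, x` such a `b` exists, every `F` with `F(4r) = F(r)`, `F(−r) = F(r)` and Manin's rule (5) is
  multiplicative; `cuspSpanEvenAtTwo_of_oneStep`: then `CuspSpanEvenAtTwo p` (via Theorem C⁻(p), `…CuspSpanFunctionalNeg`).

WHY: the all-pairs condition needs `p ≳ n⁴` (`n = [𝔽ₚˣ : H]`); the one-step condition holds as soon as every row of the cyclotomic matrix has
fewer than a third unrealised entries, which a SECOND-MOMENT count gives for `p ≳ 3n³` (companion file `…CuspSpanJacobiMoment`). Seat numerics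
(`analysis/propagate.py`): the one-step condition holds at every odd prime `< 1000` except `241, 257, 397, 683`; the full cocycle closure (iterate)
fills `Q × Q` at every prime tested, in ≤ 2 rounds.

References: Ju. I. Manin, Izv. 36 (1972) §1.5 [Manin1972]; K. Ireland, M. Rosen, GTM 84, Ch. 8; [Pollack2003] Conj. 6.3.
-/

set_option autoImplicit false
set_option linter.dupNamespace false

open scoped MatrixGroups

open CongruenceSubgroup

namespace Summit.BirchSwinnertonDyer.BirchSwinnertonDyer.Theorems.SignedMuAtTwo

variable {p : ℕ} [Fact p.Prime]

/-- **Realised pair ⟹ vanishing coboundary.** If `h₁, h₂ ∈ ⟨4, −1⟩` have `s h₁ + s t h₂ = 1`, then for every `F` with `F(4r) = F(r)`,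
`F(−r) = F(r)` (`r ≠ 0`) and Manin's rule `F u + F ((u−1)/u) + F (u−1) = 0`: `F(st) = F(s) + F(t)`. [cite: Manin1972, §1.5] -/
theorem add_eq_of_realised (hp2 : p ≠ 2) (F : ZMod p → ZMod 2)
    (h4 : ∀ r : ZMod p, r ≠ 0 → F (4 * r) = F r)
    (h5 : ∀ u : ZMod p, u ≠ 0 → u - 1 ≠ 0 → F u + F ((u - 1) * u⁻¹) + F (u - 1) = 0)
    (h7 : ∀ r : ZMod p, r ≠ 0 → F (-r) = F r)
    (s t : (ZMod p)ˣ) {h₁ h₂ : (ZMod p)ˣ}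
    (hh₁ : h₁ ∈ Subgroup.closure {w : (ZMod p)ˣ | (w : ZMod p) = 4 ∨ (w : ZMod p) = -1})
    (hh₂ : h₂ ∈ Subgroup.closure {w : (ZMod p)ˣ | (w : ZMod p) = 4 ∨ (w : ZMod p) = -1})
    (hsum : ((s * h₁ : (ZMod p)ˣ) : ZMod p) + ((s * t * h₂ : (ZMod p)ˣ) : ZMod p) = 1) :
    F ((s * t : (ZMod p)ˣ) : ZMod p) = F (s : ZMod p) + F (t : ZMod p) := by
  have h40 : (4 : ZMod p) ≠ 0 := by
    have hp : p.Prime := Fact.out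
    intro h0
    have h0' : ((4 : ℕ) : ZMod p) = 0 := by exact_mod_cast h0
    have h4' : p ∣ 2 ^ 2 := by norm_num; exact (ZMod.natCast_eq_zero_iff 4 p).mp h0'
    exact hp2 ((Nat.prime_dvd_prime_iff_eq hp Nat.prime_two).mp (hp.dvd_of_dvd_pow h4'))
  have h4k : ∀ (k : ℕ) (r : ZMod p), r ≠ 0 → F (4 ^ k * r) = F r := by
    intro k
    induction k with
    | zero => intro r _; rw [pow_zero, one_mul]
    | succ k ih =>
      intro r hr
      rw [pow_succ, mul_comm (4 ^ k) 4, mul_assoc, h4 _ (mul_ne_zero (pow_ne_zero _ h40) hr), ih r hr]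
  -- `F(h r) = F(r)` for `h ∈ H`
  have hH : ∀ {h : (ZMod p)ˣ}, h ∈ Subgroup.closure {w : (ZMod p)ˣ | (w : ZMod p) = 4 ∨ (w : ZMod p) = -1} →
      ∀ r : ZMod p, r ≠ 0 → F ((h : ZMod p) * r) = F r := by
    intro h hh r hr
    obtain ⟨k, hk⟩ := exists_eq_pm_four_pow_of_mem_closure hp2 hh
    rcases hk with hk | hk
    · rw [hk, h4k k r hr]
    · rw [hk, neg_mul, h7 _ (mul_ne_zero (pow_ne_zero _ h40) hr), h4k k r hr]
  rw [Units.val_mul, Units.val_mul, Units.val_mul] at hsum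
  set u : ZMod p := (s : ZMod p) * h₁ with hu
  have hu0 : u ≠ 0 := mul_ne_zero s.ne_zero h₁.ne_zero
  have hu1 : u - 1 = -((s : ZMod p) * t * h₂) := by rw [hu]; linear_combination hsum
  have hu10 : u - 1 ≠ 0 := by
    rw [hu1]; exact neg_ne_zero.mpr (mul_ne_zero (mul_ne_zero s.ne_zero t.ne_zero) h₂.ne_zero)
  have e1 : F u = F s := by rw [hu, mul_comm, hH hh₁ _ s.ne_zero]
  have e2 : F (u - 1) = F ((s * t : (ZMod p)ˣ) : ZMod p) := by
    rw [hu1, h7 _ (mul_ne_zero (mul_ne_zero s.ne_zero t.ne_zero) h₂.ne_zero), mul_comm, hH hh₂ _ (mul_ne_zero s.ne_zero t.ne_zero),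
      Units.val_mul]
  have e3 : F ((u - 1) * u⁻¹) = F t := by
    have e : (u - 1) * u⁻¹ = -((h₂ : ZMod p) * ((h₁ : ZMod p)⁻¹ * t)) := by
      rw [hu1, hu]; field_simp
    rw [e, h7 _ (mul_ne_zero h₂.ne_zero (mul_ne_zero (inv_ne_zero h₁.ne_zero) t.ne_zero)),
      hH hh₂ _ (mul_ne_zero (inv_ne_zero h₁.ne_zero) t.ne_zero)]
    -- `F (h₁⁻¹ t) = F t`: `h₁ (h₁⁻¹ t) = t`
    have e' := hH hh₁ ((h₁ : ZMod p)⁻¹ * t) (mul_ne_zero (inv_ne_zero h₁.ne_zero) t.ne_zero)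
    rw [← mul_assoc, mul_inv_cancel₀ h₁.ne_zero, one_mul] at e'
    rw [← e']
  have h := h5 u hu0 hu10
  rw [e1, e2, e3] at h
  have e : F ((s * t : (ZMod p)ˣ) : ZMod p) = -(F (s : ZMod p) + F (t : ZMod p)) := by linear_combination h
  rw [e, ZMod.neg_eq_self_mod_two]

/-- **One-step propagation criterion.** Write `Good(s, c)` for «some `h₁, h₂ ∈ ⟨4, −1⟩` have `s h₁ + c h₂ = 1`». If for all units `a, x`
some unit `b` has `Good(a, ab)`, `Good(ab, ax)` and `Good(b, x)`, then every `F : 𝔽ₚ → 𝔽₂` with `F(4r) = F(r)`, `F(−r) = F(r)` and Manin's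
rule (5) is multiplicative on the units (2-cocycle identity `D(a,x) = D(a,b) + D(ab,x/b) + D(b,x/b)`). [cite: Manin1972, §1.5] -/
theorem mul_of_oneStep (hp2 : p ≠ 2)
    (hstep : ∀ a x : (ZMod p)ˣ, ∃ b : (ZMod p)ˣ,
      (∃ h₁ ∈ Subgroup.closure {w : (ZMod p)ˣ | (w : ZMod p) = 4 ∨ (w : ZMod p) = -1},
        ∃ h₂ ∈ Subgroup.closure {w : (ZMod p)ˣ | (w : ZMod p) = 4 ∨ (w : ZMod p) = -1},
          ((a * h₁ : (ZMod p)ˣ) : ZMod p) + ((a * b * h₂ : (ZMod p)ˣ) : ZMod p) = 1) ∧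
      (∃ h₁ ∈ Subgroup.closure {w : (ZMod p)ˣ | (w : ZMod p) = 4 ∨ (w : ZMod p) = -1},
        ∃ h₂ ∈ Subgroup.closure {w : (ZMod p)ˣ | (w : ZMod p) = 4 ∨ (w : ZMod p) = -1},
          ((a * b * h₁ : (ZMod p)ˣ) : ZMod p) + ((a * x * h₂ : (ZMod p)ˣ) : ZMod p) = 1) ∧
      (∃ h₁ ∈ Subgroup.closure {w : (ZMod p)ˣ | (w : ZMod p) = 4 ∨ (w : ZMod p) = -1},
        ∃ h₂ ∈ Subgroup.closure {w : (ZMod p)ˣ | (w : ZMod p) = 4 ∨ (w : ZMod p) = -1},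
          ((b * h₁ : (ZMod p)ˣ) : ZMod p) + ((x * h₂ : (ZMod p)ˣ) : ZMod p) = 1))
    (F : ZMod p → ZMod 2)
    (h4 : ∀ r : ZMod p, r ≠ 0 → F (4 * r) = F r)
    (h5 : ∀ u : ZMod p, u ≠ 0 → u - 1 ≠ 0 → F u + F ((u - 1) * u⁻¹) + F (u - 1) = 0)
    (h7 : ∀ r : ZMod p, r ≠ 0 → F (-r) = F r) :
    ∀ x y : ZMod p, x ≠ 0 → y ≠ 0 → F (x * y) = F x + F y := by
  intro x y hx hy
  set a : (ZMod p)ˣ := Units.mk0 x hx with ha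
  set c : (ZMod p)ˣ := Units.mk0 y hy with hc
  obtain ⟨b, ⟨h₁, hh₁, h₂, hh₂, e1⟩, ⟨k₁, hk₁, k₂, hk₂, e2⟩, ⟨l₁, hl₁, l₂, hl₂, e3⟩⟩ := hstep a c
  -- the three realised pairs: `(a, b)`, `(ab, c/b)`, `(b, c/b)`
  have d1 := add_eq_of_realised hp2 F h4 h5 h7 a b hh₁ hh₂ e1
  have d2 := add_eq_of_realised hp2 F h4 h5 h7 (a * b) (b⁻¹ * c) hk₁ hk₂
    (by rw [show a * b * (b⁻¹ * c) = a * c by group]; exact e2)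
  have d3 := add_eq_of_realised hp2 F h4 h5 h7 b (b⁻¹ * c) hl₁ hl₂
    (by rw [show b * (b⁻¹ * c) = c by group]; exact e3)
  rw [show a * b * (b⁻¹ * c) = a * c by group] at d2
  rw [show b * (b⁻¹ * c) = c by group] at d3
  have ex : x = (a : ZMod p) := by rw [ha, Units.val_mk0]
  have ey : y = (c : ZMod p) := by rw [hc, Units.val_mk0]
  rw [ex, ey, ← Units.val_mul, d2, d1, d3]
  -- `F a + F b + F (c/b) = F a + (F b + F (c/b))`
  ring

/-- **The node from the one-step propagation condition.** [cite: Pollack2003, Conj. 6.3] [cite: Manin1972, §1.5] -/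
theorem cuspSpanEvenAtTwo_of_oneStep (hp2 : p ≠ 2)
    (hstep : ∀ a x : (ZMod p)ˣ, ∃ b : (ZMod p)ˣ,
      (∃ h₁ ∈ Subgroup.closure {w : (ZMod p)ˣ | (w : ZMod p) = 4 ∨ (w : ZMod p) = -1},
        ∃ h₂ ∈ Subgroup.closure {w : (ZMod p)ˣ | (w : ZMod p) = 4 ∨ (w : ZMod p) = -1},
          ((a * h₁ : (ZMod p)ˣ) : ZMod p) + ((a * b * h₂ : (ZMod p)ˣ) : ZMod p) = 1) ∧
      (∃ h₁ ∈ Subgroup.closure {w : (ZMod p)ˣ | (w : ZMod p) = 4 ∨ (w : ZMod p) = -1},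
        ∃ h₂ ∈ Subgroup.closure {w : (ZMod p)ˣ | (w : ZMod p) = 4 ∨ (w : ZMod p) = -1},
          ((a * b * h₁ : (ZMod p)ˣ) : ZMod p) + ((a * x * h₂ : (ZMod p)ˣ) : ZMod p) = 1) ∧
      (∃ h₁ ∈ Subgroup.closure {w : (ZMod p)ˣ | (w : ZMod p) = 4 ∨ (w : ZMod p) = -1},
        ∃ h₂ ∈ Subgroup.closure {w : (ZMod p)ˣ | (w : ZMod p) = 4 ∨ (w : ZMod p) = -1},
          ((b * h₁ : (ZMod p)ˣ) : ZMod p) + ((x * h₂ : (ZMod p)ˣ) : ZMod p) = 1)) :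
    CuspSpanEvenAtTwo p :=
  cuspSpanEvenAtTwo_of_functional_criterion_neg hp2
    (fun F _ h4 _ _ hpos _ h7 _ ↦ mul_of_oneStep hp2 hstep F h4 hpos h7)

end Summit.BirchSwinnertonDyer.BirchSwinnertonDyer.Theorems.SignedMuAtTwo
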